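import Summits.Ventures.CertifiedManyBodySolver.Theses.CovLa214M2b
import Summits.Ventures.CertifiedManyBodySolver.Downfold.BoxesLa214V115M2bBoxReadShadows
import HarnessLib

/-!
# Crux `CovLa214M2b.TransportFanCeiling` (stmt-Ventures-26184) — BIRTH SKELETON (BC3 line «birth» = the plan of record, LA214-COVERAGE-PLAN v1.8.1 §0.8 (5) T2 (a))

Route pen hubbard-m2-certneg-1 (planner, cell `pub/hubbard-obs`). The crux K2 = the TRANSPORT-FAN shadow of the La214-E box
`[−3/10, −1/5] × [29/5, 74/5] × {1}`: every target `(t′, U)` whose apex source at the f-sum station `U = 29/5` LEAVES the box through the left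
edge, `t′(2 − (29/5)/U) ≤ −3/10`, carries `ObsStiffnessSeqCeilingAt t′ U 1 (4364687/10⁷)`.

LINE OF RECORD (E1 edition; BoxRead typing of hubbard-cov-la214-box-1, `Downfold/BoxesLa214V115M2bBoxRead{,Shadows,Route}`; captain §0.8 (5) T2 (a); K2 holder
hubbard-cov-la214-unc-3): ONE station object, the CORNER-OBJECTIVE `boxdual/0` read of the OVERHANG bundle `s ∈ [−357/740, −3/10] × {29/5}` for the fixed word
`−X₀(−3/10)` (vertices kit j298996 at `−357/740`, slot word 0.4005902, and kit j298764 at `−3/10`, 0.3870869; pinned spoke S2 in flight), which words EVERY K2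
target by the slot engine (`σ = −3/10`; the source `s = t′(2 − (29/5)/U)` of a K2 target lies in `[−357/740, −3/10]`). A boxdual read certifies its row GIVEN an
a-priori energy window; the window is a separate certified object (energy legs: `K₂`-diagonal bootstraps A₁ at `−357/740`, A₂ at `−3/10` for the chord floor; the
Mott column #21/#487/#427/#488 for the cap `HI29`). Hence TWO stubs, two producers:

* `stub_overhangWindow` — the energy WINDOW of the overhang bundle: `bundleChordFloor (−357/740) (−3/10) f(−357/740) f(−3/10) ≤ e(1,s,29/5,1) ≤ HI29` on
  `[−357/740, −3/10]` (in tree only modulo the claim nodes j295983/j295889/#21/#487/#427/#488: `laBoxE_overhangBundle_floor_of`, `laBoxE_u29o5_cap_of`);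
* `stub_overhangRow_underBar` — the boxdual ROW of the overhang bundle in the claim-node shape `TPrimeBundleOrbitLowerRow` with SOME certified uniform value
  `Fo`, `−Fo ≤ 4364687/10⁷` (the producer deliverable; not in tree; captain's heuristic reading of the pinning prices: TIGHT, `π_S2 ≲ 0.016`);
* `TransportFanCeiling_of` — the kernel-checked composition (row + window ⇒ unconditional corner-objective family ⇒ slot engine at every K2 target), concluding
  the route decl BY NAME. Insurance line (b) «foot» (left-edge `U`-ray + high-`U` point cover) is registered separately as `Lines/foot.lean`.

HONEST FRAMING: a skeleton, not a proof — the two `stub_*` carry `sorry` by design; stiffness CEILINGS on a downfolded box = CONTROL/CALIBRATION +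
labelled heuristic, silent on `ρ_s = 0`, never «certified true negative»; no number of record, no certificate, no phase sentence; no summit
statement is proved by this seat.
-/

noncomputable section

namespace Summit.Ventures.CertifiedManyBodySolver.Cruxes.TransportFanCeiling.Birth

open Set Filter Topology
open Summit.Ventures.CertifiedManyBodySolver.Theses.CovLa214M2b
open Summit.Ventures.CertifiedManyBodySolver.Observables
open Summit.Ventures.CertifiedManyBodySolver.Downfold
open Literature.MathematicalPhysics.QuantumLattice Literature.MathematicalPhysics.QuantumLattice.ThermodynamicLimit
open Literature.Probability.LatticeModels
open Matrix HubbardWave0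
open scoped BigOperators ComplexOrder

/-- **Stub 1 statement — the ENERGY WINDOW of the overhang bundle** `[−357/740, −3/10] × {29/5}`, `n = 1`: the declared chord floor of the two vertex
floors `f(−357/740)` (A₁ law), `f(−3/10)` (A₂ law) is below, and the `t′`-free Mott-column cap `HI29` is above, the ground-state energy density
`e(1, s, 29/5, 1)` at every `s` of the segment. [cite: Griffiths1966, §II] -/
def OverhangWindow : Prop :=
  ∀ s ∈ Set.Icc (-(357 / 740) : ℝ) (-3 / 10),
    bundleChordFloor (-(357 / 740)) (-3 / 10) laBoxE_f357o740 laBoxE_f3o10 s ≤ energyDensityTT' 1 s (29 / 5) 1 ∧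
      energyDensityTT' 1 s (29 / 5) 1 ≤ ((laBoxE_HI29 : ℚ) : ℝ)

/-- **Stub 2 statement — the boxdual ROW of the overhang bundle under the bar**: some certified uniform value `Fo` with `−Fo ≤ 4364687/10⁷` for the
CORNER objective `−X₀(−3/10)` in the bundle claim-node shape (for every `s ∈ [−357/740, −3/10]`, given the declared floor, the `D₄`-orbit-mean lower row
with cap `HI29`). [cite: BoydVandenberghe2004, §5.9] [cite: ScalapinoWhiteZhang1993, §II] -/
def OverhangRowUnderBar : Prop :=
  ∃ Fo : ℚ, -Fo ≤ 4364687 / 10000000 ∧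
    TPrimeBundleOrbitLowerRow (29 / 5) 1 (-(357 / 740)) (-3 / 10) laBoxE_f357o740 laBoxE_f3o10 laBoxE_HI29 Fo
      (fun _ => -oddMomentObsTT (-3 / 10) (29 / 5) 0)

/-- **STUB 1 (energy legs; size M: two `K₂`-diagonal bootstraps + the Mott-column window, referee/reader-B discharge of six claim nodes).**
[cite: Griffiths1966, §II] -/
theorem stub_overhangWindow : OverhangWindow := by
  sorry

/-- **STUB 2 (the producer deliverable; size L: the S2 pinned spoke, one `boxdual/0` light read of the overhang pair with its exact rational
`Fo ≥ −0.4364687`, then the claim node and its reader-B/referee legs).** [cite: BoydVandenberghe2004, §5.9] -/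
theorem stub_overhangRow_underBar : OverhangRowUnderBar := by
  sorry

/-- **COMPOSITION (kernel-checked, no `sorry` of its own): window + row ⇒ `TransportFanCeiling`.** The row read against the discharged window is an
unconditional corner-objective orbit-lower family with the constant value `Fo` on `[−357/740, −3/10]`; every K2 target's station source lies there, and the
slot engine `ObsStiffnessSeqCeilingAt_halfFilling_of_apexSource_orbitLower_slot` (`σ = −3/10`, slot weight `(2σ − 2t′)/s ≥ 0`) words it at `−Fo ≤ bar`.
[cite: KomaTasaki1994, §1] [cite: ScalapinoWhiteZhang1993, §II] -/
theorem TransportFanCeiling_of (hW : OverhangWindow) (hR : OverhangRowUnderBar) :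
    Summit.Ventures.CertifiedManyBodySolver.Theses.CovLa214M2b.TransportFanCeiling := by
  obtain ⟨Fo, hbar, hO⟩ := hR
  intro tp htp U hU hsrc
  have hco' : -((Fo : ℚ) : ℝ) ≤ ((4364687 / 10000000 : ℚ) : ℝ) := by exact_mod_cast hbar
  have hfam := hO.orbitLower (fun s hs => (hW s hs).1) (fun s hs => (hW s hs).2)
  obtain ⟨-, e₂⟩ := laBoxE_apexSource29o5_eq (tp := tp) hU.1
  have hlo := (laBoxE_apexSource29o5_mem htp hU).1
  set s : ℝ := tp * (2 - 29 / 5 / U) with hs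
  have hsneg : s < 0 := by linarith
  have hs0 : s ≠ 0 := hsneg.ne
  have hsmem : s ∈ Set.Icc (-(357 / 740) : ℝ) (-3 / 10) := ⟨hlo, hsrc⟩
  have hslot : 2 * (-3 / 10 : ℝ) - 2 * tp = (2 * (-3 / 10) - 2 * tp) / s * s := by rw [div_mul_cancel₀ _ hs0]
  exact ObsStiffnessSeqCeilingAt_halfFilling_of_apexSource_orbitLower_slot (t'A := s) (UA := 29 / 5) (-3 / 10) (29 / 5)
    ((Fo : ℚ) : ℝ) (by norm_num) hU.1 (by linarith [hU.1]) e₂ (hfam s hsmem)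
    (div_nonneg_of_nonpos (by linarith [htp.1]) hsneg.le) hslot (4364687 / 10000000) hco'

/-- The skeleton decides the crux from its two stubs (the line's shape, for the record). -/
theorem TransportFanCeiling_of_stubs : Summit.Ventures.CertifiedManyBodySolver.Theses.CovLa214M2b.TransportFanCeiling :=
  TransportFanCeiling_of stub_overhangWindow stub_overhangRow_underBar

end Summit.Ventures.CertifiedManyBodySolver.Cruxes.TransportFanCeiling.Birth

end
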